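import Mathlib
import Summits.NavierStokesRegularity.FluidComputer.AbcClassIIDefs

/-!
# Class-II layer of the skew-cut X0 chain, Part O: signed-permutation orbits and the index sets
(instab4 g6 — implementation 2 of the skew-cut X0 certifier, cell `ns-blowup`, 2026-08-26)

HONEST FRAMING (human ruling D-0035): nothing here is a claim about Navier–Stokes blow-up.
WHAT THIS IS NOT: not NS evidence. MODEL lane (linearisation about the forced ABC flow 1:1:1).
Sequel of `AbcClassIIDefs` (p470515): the PROPERTIES of the objects defined there.

* Part O — signed-permutation orbits: group-like closure (`sgnOrbit_eq_of_mem`), symmetry under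
  `k ↦ −k` and under the frequency maps of the generators `r`, `s`; one sphere, one sup-norm shell,
  `≤ 48` points; the `Orbit` type, `cubeOrbits`/`cubeIdx` (monotone, exhausting), `nbrOrbits`/`nbrIdx`
  (symmetric, `≤ 288` orbits).
* (Part S — closure properties of class II / conjugate symmetry / transversality — is the sequel
  `AbcClassIISymmetry`.)

Mathlib + the files named; no new definitions.
-/

noncomputable section

open scoped BigOperators ComplexConjugate InnerProductSpace
open Finset MeasureTheory UnitAddTorus

namespace Summit.NavierStokesRegularity.FluidComputer.AbcClassII

open Literature.Analysis.FunctionSpaces Literature.Analysis.FunctionSpaces.Torus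
open Literature.Analysis.FunctionSpaces.EuclideanSpace
open Literature.Analysis.FluidPDE Literature.Analysis.FluidPDE.SteadyLattice
open Literature.Analysis.FluidPDE.ScalarFourier

/-! ## Part O. Orbit combinatorics (instab4 g6) -/

section Orbits

/-- Points of the orbit: `m ∈ sgnOrbit k ↔ m = g • k` for some signed permutation `g`. -/
theorem mem_sgnOrbit {k m : Fin 3 → ℤ} : m ∈ sgnOrbit k ↔ ∃ g, sgnAct g k = m := by
  simp [sgnOrbit]

/-- `k ∈ sgnOrbit k` (identity). -/
theorem mem_sgnOrbit_self (k : Fin 3 → ℤ) : k ∈ sgnOrbit k :=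
  mem_sgnOrbit.mpr ⟨(1, fun _ => true), by funext i; simp [sgnAct]⟩

/-- An orbit has at most `48 = 3!·2³` points. -/
theorem card_sgnOrbit_le (k : Fin 3 → ℤ) : (sgnOrbit k).card ≤ 48 := by
  refine (Finset.card_image_le).trans ?_
  simp [Fintype.card_perm, Nat.factorial]

/-- Composition of signed permutations: `g • (h • k) = (gh) • k` for an explicit `gh`. -/
theorem sgnAct_sgnAct (g h : Equiv.Perm (Fin 3) × (Fin 3 → Bool)) (k : Fin 3 → ℤ) :
    sgnAct g (sgnAct h k) =
      sgnAct (g.1.trans h.1, fun i => (g.2 i == h.2 (g.1 i))) k := by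
  funext i
  simp only [sgnAct, Equiv.trans_apply]
  rcases Bool.eq_false_or_eq_true (g.2 i) with hg | hg <;>
    rcases Bool.eq_false_or_eq_true (h.2 (g.1 i)) with hh | hh <;> simp [hg, hh]

/-- Inversion of a signed permutation: `g' • (g • k) = k` for an explicit `g'`. -/
theorem sgnAct_inv (g : Equiv.Perm (Fin 3) × (Fin 3 → Bool)) (k : Fin 3 → ℤ) :
    sgnAct (g.1.symm, fun i => g.2 (g.1.symm i)) (sgnAct g k) = k := by
  funext i
  simp only [sgnAct, Equiv.apply_symm_apply]
  cases g.2 (g.1.symm i) <;> simp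

/-- Orbits are orbits: a point of the orbit of `k` has the same orbit. -/
theorem sgnOrbit_eq_of_mem {k m : Fin 3 → ℤ} (hm : m ∈ sgnOrbit k) : sgnOrbit m = sgnOrbit k := by
  obtain ⟨g, rfl⟩ := mem_sgnOrbit.mp hm
  ext m'
  simp only [mem_sgnOrbit]
  constructor
  · rintro ⟨h, rfl⟩
    exact ⟨_, (sgnAct_sgnAct h g k).symm⟩
  · rintro ⟨h, rfl⟩
    have e := sgnAct_sgnAct h (g.1.symm, fun i => g.2 (g.1.symm i)) (sgnAct g k)
    rw [sgnAct_inv] at e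
    exact ⟨_, e.symm⟩

/-- Membership is symmetric: `m ∈ sgnOrbit k ↔ k ∈ sgnOrbit m`. -/
theorem mem_sgnOrbit_comm {k m : Fin 3 → ℤ} : m ∈ sgnOrbit k ↔ k ∈ sgnOrbit m := by
  constructor
  · intro h; rw [sgnOrbit_eq_of_mem h]; exact mem_sgnOrbit_self k
  · intro h; rw [sgnOrbit_eq_of_mem h]; exact mem_sgnOrbit_self m

/-- Two orbits are equal or disjoint. -/
theorem sgnOrbit_eq_or_disjoint (k k' : Fin 3 → ℤ) :
    sgnOrbit k = sgnOrbit k' ∨ Disjoint (sgnOrbit k) (sgnOrbit k') := by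
  by_cases h : Disjoint (sgnOrbit k) (sgnOrbit k')
  · exact Or.inr h
  · left
    obtain ⟨m, hm, hm'⟩ := Finset.not_disjoint_iff.mp h
    rw [← sgnOrbit_eq_of_mem hm, sgnOrbit_eq_of_mem hm']

/-- The orbit is symmetric under `k ↦ −k`. -/
theorem neg_mem_sgnOrbit {k m : Fin 3 → ℤ} (hm : m ∈ sgnOrbit k) : -m ∈ sgnOrbit k := by
  obtain ⟨g, rfl⟩ := mem_sgnOrbit.mp hm
  refine mem_sgnOrbit.mpr ⟨(g.1, fun i => !g.2 i), ?_⟩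
  funext i
  simp only [sgnAct, Pi.neg_apply]
  rcases Bool.eq_false_or_eq_true (g.2 i) with hg | hg <;> simp [hg]

/-- `−k ∈ sgnOrbit k`. -/
theorem neg_self_mem_sgnOrbit (k : Fin 3 → ℤ) : -k ∈ sgnOrbit k := neg_mem_sgnOrbit (mem_sgnOrbit_self k)

/-- The frequency map of the generator `r`, `m ↦ M_rᵀ m = (m_{i+2})_i`, stays in the orbit. -/
theorem rotFreqR_mem_sgnOrbit (m : Fin 3 → ℤ) :
    (fun i : Fin 3 => m ((finRotate 3).symm i)) ∈ sgnOrbit m :=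
  mem_sgnOrbit.mpr ⟨((finRotate 3).symm, fun _ => true), by funext i; simp [sgnAct]⟩

/-- The frequency map of the generator `s`, `m ↦ M_sᵀ m = (m₀, −m₂, m₁)`, stays in the orbit. -/
theorem rotFreqS_mem_sgnOrbit (m : Fin 3 → ℤ) :
    (fun i : Fin 3 => (![1, 1, -1] : Fin 3 → ℤ) ((Equiv.swap (1 : Fin 3) 2).symm i) *
      m ((Equiv.swap (1 : Fin 3) 2).symm i)) ∈ sgnOrbit m := by
  refine mem_sgnOrbit.mpr ⟨((Equiv.swap (1 : Fin 3) 2).symm,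
    fun i => decide ((![1, 1, -1] : Fin 3 → ℤ) ((Equiv.swap (1 : Fin 3) 2).symm i) = 1)), ?_⟩
  funext i
  simp only [sgnAct]
  fin_cases i <;> simp [Equiv.swap_apply_of_ne_of_ne, Equiv.swap_apply_left, Equiv.swap_apply_right]

/-- `|g • k|² = |k|²`: an orbit lies on one Euclidean sphere. -/
theorem freqNormSq_sgnAct (g : Equiv.Perm (Fin 3) × (Fin 3 → Bool)) (k : Fin 3 → ℤ) :
    freqNormSq (sgnAct g k) = freqNormSq k := by
  simp only [freqNormSq, sgnAct, Int.cast_mul]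
  have : ∀ i, (((if g.2 i then (1 : ℤ) else -1) : ℤ) : ℝ) ^ 2 = 1 := fun i => by
    cases g.2 i <;> simp
  simp_rw [mul_pow, this, one_mul]
  exact Equiv.sum_comp g.1 (fun i => ((k i : ℤ) : ℝ) ^ 2)

/-- `|m|² = |k|²` on the orbit of `k`. -/
theorem freqNormSq_eq_of_mem_sgnOrbit {k m : Fin 3 → ℤ} (hm : m ∈ sgnOrbit k) :
    freqNormSq m = freqNormSq k := by
  obtain ⟨g, rfl⟩ := mem_sgnOrbit.mp hm
  exact freqNormSq_sgnAct g k

/-- `‖g • k‖_∞ = ‖k‖_∞`: an orbit lies in one sup-norm shell. -/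
theorem supNorm_sgnAct (g : Equiv.Perm (Fin 3) × (Fin 3 → Bool)) (k : Fin 3 → ℤ) :
    supNorm (sgnAct g k) = supNorm k := by
  simp only [supNorm, sgnAct]
  have : ∀ i, ((if g.2 i then (1 : ℤ) else -1) * k (g.1 i)).natAbs = (k (g.1 i)).natAbs := fun i => by
    cases g.2 i <;> simp
  simp_rw [this]
  apply le_antisymm
  · refine Finset.sup_le fun i _ => ?_
    exact Finset.le_sup (f := fun i => (k i).natAbs) (Finset.mem_univ (g.1 i))
  · refine Finset.sup_le fun i _ => ?_
    have := Finset.le_sup (f := fun i => (k (g.1 i)).natAbs) (Finset.mem_univ (g.1.symm i))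
    simpa using this

/-- `‖m‖_∞ = ‖k‖_∞` on the orbit of `k`. -/
theorem supNorm_eq_of_mem_sgnOrbit {k m : Fin 3 → ℤ} (hm : m ∈ sgnOrbit k) : supNorm m = supNorm k := by
  obtain ⟨g, rfl⟩ := mem_sgnOrbit.mp hm
  exact supNorm_sgnAct g k

/-- `|k_i| ≤ ‖k‖_∞`. -/
theorem natAbs_le_supNorm (k : Fin 3 → ℤ) (i : Fin 3) : (k i).natAbs ≤ supNorm k :=
  Finset.le_sup (f := fun i => (k i).natAbs) (Finset.mem_univ i)

/-- Membership in the cube: `k ∈ cube n ↔ ∀ i, |k i| ≤ n`. -/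
theorem mem_cube {n : ℕ} {k : Fin 3 → ℤ} : k ∈ cube n ↔ ∀ i, |k i| ≤ (n : ℤ) := by
  simp only [cube, Fintype.mem_piFinset, Finset.mem_Icc, abs_le]

/-- `k ∈ cube n ↔ ‖k‖_∞ ≤ n`. -/
theorem mem_cube_iff_supNorm {n : ℕ} {k : Fin 3 → ℤ} : k ∈ cube n ↔ supNorm k ≤ n := by
  rw [mem_cube]
  constructor
  · intro h
    refine Finset.sup_le fun i _ => ?_
    have := h i
    rw [Int.abs_eq_natAbs] at this
    exact_mod_cast this
  · intro h i
    rw [Int.abs_eq_natAbs]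
    exact_mod_cast (natAbs_le_supNorm k i).trans h

/-- Cubes are monotone. -/
theorem cube_mono {m n : ℕ} (h : m ≤ n) : cube m ⊆ cube n := fun _ hk =>
  mem_cube_iff_supNorm.mpr ((mem_cube_iff_supNorm.mp hk).trans h)

/-- An orbit meeting the cube lies in it. -/
theorem sgnOrbit_subset_cube {n : ℕ} {k : Fin 3 → ℤ} (hk : k ∈ cube n) : sgnOrbit k ⊆ cube n :=
  fun _ hm => mem_cube_iff_supNorm.mpr ((supNorm_eq_of_mem_sgnOrbit hm).le.trans (mem_cube_iff_supNorm.mp hk))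

/-- `g • k = 0 ↔ k = 0`; in particular `0 ∉ sgnOrbit k` for `k ≠ 0`. -/
theorem zero_not_mem_sgnOrbit {k : Fin 3 → ℤ} (hk : k ≠ 0) : (0 : Fin 3 → ℤ) ∉ sgnOrbit k := by
  intro h0
  obtain ⟨g, hg⟩ := mem_sgnOrbit.mp h0
  apply hk
  have := sgnAct_inv g k
  rw [hg] at this
  rw [← this]
  funext i
  simp [sgnAct]

/-- Every point of an orbit of a non-zero frequency is non-zero. -/
theorem ne_zero_of_mem_sgnOrbit {k m : Fin 3 → ℤ} (hk : k ≠ 0) (hm : m ∈ sgnOrbit k) : m ≠ 0 := by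
  rintro rfl; exact zero_not_mem_sgnOrbit hk hm

/-! ### The `Orbit` type -/

/-- Unfolding `toOrbit`. -/
theorem toOrbit_val (k : Fin 3 → ℤ) (hk : k ≠ 0) : (toOrbit k hk).1 = sgnOrbit k := rfl

/-- The representative lies in the orbit and is non-zero, and the orbit is its orbit. -/
theorem Orbit.rep_spec (O : Orbit) : O.rep ≠ 0 ∧ sgnOrbit O.rep = O.1 := O.2.choose_spec

/-- The representative is a point of the orbit. -/
theorem Orbit.rep_mem (O : Orbit) : O.rep ∈ O.1 := by
  rw [← O.rep_spec.2]; exact mem_sgnOrbit_self _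

/-- For `k ∈ O`: `sgnOrbit k = O`. -/
theorem Orbit.sgnOrbit_eq (O : Orbit) {k : Fin 3 → ℤ} (hk : k ∈ O.1) : sgnOrbit k = O.1 := by
  have h := O.rep_spec.2
  rw [← h] at hk ⊢
  exact sgnOrbit_eq_of_mem hk

/-- Points of an orbit are non-zero. -/
theorem Orbit.ne_zero_of_mem (O : Orbit) {k : Fin 3 → ℤ} (hk : k ∈ O.1) : k ≠ 0 := by
  have h := O.rep_spec
  rw [← h.2] at hk
  exact ne_zero_of_mem_sgnOrbit h.1 hk

/-- `toOrbit k = O ↔ k ∈ O`. -/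
theorem toOrbit_eq_iff {k : Fin 3 → ℤ} (hk : k ≠ 0) (O : Orbit) : toOrbit k hk = O ↔ k ∈ O.1 := by
  constructor
  · rintro rfl; exact mem_sgnOrbit_self k
  · intro h; exact Subtype.ext (O.sgnOrbit_eq h)

/-- `|k|² = onormSq O` on the orbit. -/
theorem Orbit.freqNormSq_eq (O : Orbit) {k : Fin 3 → ℤ} (hk : k ∈ O.1) : freqNormSq k = onormSq O := by
  rw [onormSq]
  have h := O.rep_spec.2
  rw [← h] at hk
  exact freqNormSq_eq_of_mem_sgnOrbit hk

/-- `‖k‖_∞ = osupNorm O` on the orbit. -/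
theorem Orbit.supNorm_eq (O : Orbit) {k : Fin 3 → ℤ} (hk : k ∈ O.1) : supNorm k = osupNorm O := by
  rw [osupNorm]
  have h := O.rep_spec.2
  rw [← h] at hk
  exact supNorm_eq_of_mem_sgnOrbit hk

/-- `onormSq O ≥ 1` (non-zero integer vectors). -/
theorem Orbit.one_le_onormSq (O : Orbit) : 1 ≤ onormSq O := by
  rw [onormSq]
  have hk := O.rep_spec.1
  -- some coordinate is a non-zero integer
  obtain ⟨i, hi⟩ : ∃ i, O.rep i ≠ 0 := by
    by_contra h; push Not at h; exact hk (funext h)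
  have h1 : (1 : ℝ) ≤ ((O.rep i : ℤ) : ℝ) ^ 2 := by
    have : (1 : ℤ) ≤ (O.rep i) ^ 2 := by nlinarith [Int.one_le_abs hi, sq_abs (O.rep i)]
    exact_mod_cast this
  exact h1.trans (Finset.single_le_sum (f := fun j => ((O.rep j : ℤ) : ℝ) ^ 2) (fun _ _ => sq_nonneg _)
    (Finset.mem_univ i))

/-- The orbit is symmetric: `k ∈ O → −k ∈ O`. -/
theorem Orbit.neg_mem (O : Orbit) {k : Fin 3 → ℤ} (hk : k ∈ O.1) : -k ∈ O.1 := by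
  rw [← O.sgnOrbit_eq hk]; exact neg_self_mem_sgnOrbit k

/-- The orbit is closed under the frequency map of `r`. -/
theorem Orbit.rotFreqR_mem (O : Orbit) {m : Fin 3 → ℤ} (hm : m ∈ O.1) :
    (fun i : Fin 3 => m ((finRotate 3).symm i)) ∈ O.1 := by
  rw [← O.sgnOrbit_eq hm]; exact rotFreqR_mem_sgnOrbit m

/-- The orbit is closed under the frequency map of `s`. -/
theorem Orbit.rotFreqS_mem (O : Orbit) {m : Fin 3 → ℤ} (hm : m ∈ O.1) :
    (fun i : Fin 3 => (![1, 1, -1] : Fin 3 → ℤ) ((Equiv.swap (1 : Fin 3) 2).symm i) *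
      m ((Equiv.swap (1 : Fin 3) 2).symm i)) ∈ O.1 := by
  rw [← O.sgnOrbit_eq hm]; exact rotFreqS_mem_sgnOrbit m

/-- Orbits have at most 48 points. -/
theorem Orbit.card_le (O : Orbit) : O.1.card ≤ 48 := by
  rw [← O.rep_spec.2]; exact card_sgnOrbit_le _

/-- Distinct orbits are disjoint. -/
theorem Orbit.disjoint_of_ne {O O' : Orbit} (h : O ≠ O') : Disjoint O.1 O'.1 := by
  rw [← O.rep_spec.2, ← O'.rep_spec.2]
  rcases sgnOrbit_eq_or_disjoint O.rep O'.rep with he | hd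
  · exact absurd (Subtype.ext (by rw [← O.rep_spec.2, ← O'.rep_spec.2, he])) h
  · exact hd

/-- Membership in `cubeOrbits n`: the orbit lies in the cube `n` (equivalently `osupNorm O ≤ n`). -/
theorem mem_cubeOrbits {n : ℕ} {O : Orbit} : O ∈ cubeOrbits n ↔ osupNorm O ≤ n := by
  simp only [cubeOrbits, Finset.mem_image, Finset.mem_attach, true_and, Subtype.exists,
    Finset.mem_filter]
  constructor
  · rintro ⟨k, ⟨hk, hk0⟩, hO⟩
    rw [← (toOrbit_eq_iff hk0 O).mp hO |> O.supNorm_eq]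
    exact mem_cube_iff_supNorm.mp hk
  · intro h
    refine ⟨O.rep, ⟨mem_cube_iff_supNorm.mpr ?_, O.rep_spec.1⟩, (toOrbit_eq_iff _ O).mpr O.rep_mem⟩
    rw [O.supNorm_eq O.rep_mem]; exact h

/-- Membership in `cubeIdx n`. -/
theorem mem_cubeIdx {n : ℕ} {i : Idx} : i ∈ cubeIdx n ↔ osupNorm i.1 ≤ n := by
  refine (Finset.mem_sigma (s := cubeOrbits n) (t := fun O => (Finset.univ : Finset (Fin (odim O))))
    (a := i)).trans ?_
  simp [mem_cubeOrbits]

/-- The section index sets are monotone. -/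
theorem cubeIdx_mono : Monotone cubeIdx := fun _ _ h _ hi =>
  mem_cubeIdx.mpr ((mem_cubeIdx.mp hi).trans h)

/-- The section index sets exhaust the index type. -/
theorem exists_mem_cubeIdx (i : Idx) : ∃ n, i ∈ cubeIdx n := ⟨osupNorm i.1, mem_cubeIdx.mpr le_rfl⟩

/-- Membership in `nbrOrbits O`: the orbit `O'` contains a non-zero point `k − s`, `k ∈ O`, `s ∈ {±e_j}`. -/
theorem mem_nbrOrbits {O O' : Orbit} :
    O' ∈ nbrOrbits O ↔ ∃ k ∈ O.1, ∃ s ∈ Torus.abcFreq, k - s ∈ O'.1 := by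
  simp only [nbrOrbits, Finset.mem_image, Finset.mem_attach, true_and, Subtype.exists,
    Finset.mem_filter, Finset.mem_product]
  constructor
  · rintro ⟨m, ⟨⟨⟨k, s⟩, ⟨hk, hs⟩, rfl⟩, hm0⟩, hO'⟩
    exact ⟨k, hk, s, hs, (toOrbit_eq_iff hm0 O').mp hO'⟩
  · rintro ⟨k, hk, s, hs, hks⟩
    exact ⟨k - s, ⟨⟨⟨k, s⟩, ⟨hk, hs⟩, rfl⟩, O'.ne_zero_of_mem hks⟩, (toOrbit_eq_iff _ O').mpr hks⟩

/-- The neighbour relation on orbits is symmetric. -/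
theorem mem_nbrOrbits_comm {O O' : Orbit} : O' ∈ nbrOrbits O ↔ O ∈ nbrOrbits O' := by
  rw [mem_nbrOrbits, mem_nbrOrbits]
  constructor
  · rintro ⟨k, hk, s, hs, hks⟩
    exact ⟨k - s, hks, -s, Torus.neg_mem_abcFreq s hs, by simpa using hk⟩
  · rintro ⟨k, hk, s, hs, hks⟩
    exact ⟨k - s, hks, -s, Torus.neg_mem_abcFreq s hs, by simpa using hk⟩

/-- Membership in `nbrIdx i`. -/
theorem mem_nbrIdx {i j : Idx} : j ∈ nbrIdx i ↔ j.1 ∈ nbrOrbits i.1 := by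
  refine (Finset.mem_sigma (s := nbrOrbits i.1) (t := fun O => (Finset.univ : Finset (Fin (odim O))))
    (a := j)).trans ?_
  simp

/-- The band is symmetric. -/
theorem mem_nbrIdx_comm (i j : Idx) : j ∈ nbrIdx i ↔ i ∈ nbrIdx j := by
  rw [mem_nbrIdx, mem_nbrIdx, mem_nbrOrbits_comm]

/-- At most `48·6` neighbouring orbits. -/
theorem card_nbrOrbits_le (O : Orbit) : (nbrOrbits O).card ≤ 48 * 6 := by
  refine Finset.card_image_le.trans ?_
  rw [Finset.card_attach]
  refine (Finset.card_filter_le _ _).trans (Finset.card_image_le.trans ?_)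
  rw [Finset.card_product]
  have h6 : Torus.abcFreq.card ≤ 6 := by
    refine (Finset.card_image_le).trans ?_
    simp
  exact Nat.mul_le_mul O.card_le h6

end Orbits

end Summit.NavierStokesRegularity.FluidComputer.AbcClassII

end
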